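import Summits.CriticalPhenomena.PercolationContinuityZ3.Theorems.PercNearOneGluingNoHeavyLowerTailAntipodalR1FoldingRC
import Summits.CriticalPhenomena.PercolationContinuityZ3.Theorems.PercNearOneGluingNoHeavyLowerTailAntipodalR1GradedFibreForm
import Summits.CriticalPhenomena.PercolationContinuityZ3.Theorems.PercNearOneGluingNoHeavyLowerTailRefinedRowR3Switching
import HarnessLib

/-!
# LEMMA F: graded ANTI₁ implies the refined row R1 for random-cluster measures (every `q > 0`)

Support file for `stmt-CriticalPhenomena-4575` (memo `prim-gen-kcluster/KCLUSTER-gen52.md` §1 LEMMA F,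
§3; `KCLUSTER-gen78.md`).  No definitions, no named facts, no sorries.  Vocabulary: `AntipodalR1`
(`clus`, `region`, `lSet`, `rSet`; gen 62), the tree's clusters `Gladkov.cl`, support separation
`RefinedRowR3.Sep`, the random-cluster measure with edge parameters `rcMeasureW`, and gen 78's
`…FoldingRC` (graded folding) and `…GradedFibreForm` (graded ANTI₁ ⟹ fibre form).

**Theorem** (`r1_rc_of_graded_anti1`).  Fix a finite vertex type `V`.  Suppose ANTI₁-GRADED holds for
every finite multigraph on `V` (every edge system `ends' : ↥M → Sym2 V`, `M ⊆ Sym2 V`, all `a, b, c`,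
all levels).  Then for every edge-parameter vector `w` vanishing off `D₀`, every `q > 0` and all
`a, b, c`, the free random-cluster measure `φ = rcMeasureW w q ∅` satisfies the refined row R1
`φ(b, c ∈ C_a) · φ(b, c ∉ C_a, C_a separates b|c in D₀) ≤ φ(b ∈ C_a, c ∉ C_a) · φ(b ∉ C_a, c ∈ C_a)`
(the form of `ThreeSum.kThreeN_r1`).

Proof (the dictionary).  By `rcMeasureW_real_mul_le_of_graded_fibrewise` it suffices to compare, on
each fibre `(M, u)` (`u ∩ M = ∅`, `M ∪ u ⊆ D₀`) and at each level, the number of configurations `η` with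
`η \ M = u`, `η` in the first event, `η ∆ M` in the second.  Reading `η = u ∪ {e ∈ M : A e}` as the
colouring `A ⊕ (p ↦ p.2)` of the pair system `Sum.elim (↥M ↪ Sym2 V) (↥u × Bool → Sym2 V)` (free edges
`M`, doubled edges `u`): the open graph is `fromEdgeSet η`, the closed graph is `fromEdgeSet (η ∆ M)`
(`colSet_true_eq`, `colSet_false_eq`), so `Gladkov.cl` is `AntipodalR1.clus`, the grade is
`k(η) + k(η ∆ M)`, and support separation in `D₀ ⊇ M ∪ u` implies the region condition of `L`
(`not_region_of_sep`).  Hence the first count is at most `#L_t` and the second equals `#R_t` of the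
fibre form, which `card_fibreForm_grade_le_of_graded` compares.  [this work]
-/

noncomputable section

namespace Summit.CriticalPhenomena.PercolationContinuityZ3.Theorems

namespace AntipodalR1

open MeasureTheory Set Finset SimpleGraph Relation
open scoped symmDiff Classical
open Literature.Probability.Percolation (BondConfig openGraph)
open Literature.Probability.Percolation.Gladkov (cl mem_cl touch mk_mem_touch)
open Literature.Probability.LatticeModels (rcMeasureW clusterCount wired_empty)
open RefinedRowR3 (Sep)

universe u₀

variable {V : Type u₀}

section Fibre

variable {M u : Set (Sym2 V)}

/-- The open edge set of the pair system: `u ∪ {e ∈ M : A e}`. [this work] -/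
theorem colSet_true_eq (A : ↥M → Bool) :
    {s : Sym2 V | ∃ e, Sum.elim A Prod.snd e = true ∧
        Sum.elim (fun e : ↥M => (e : Sym2 V)) (fun p : ↥u × Bool => (p.1 : Sym2 V)) e = s} =
      {s : Sym2 V | s ∈ u ∨ ∃ h : s ∈ M, A ⟨s, h⟩ = true} := by
  ext s
  constructor
  · rintro ⟨e, he, hs⟩
    rcases e with e | ⟨k, β⟩
    · exact Or.inr ⟨hs ▸ e.2, by rw [show (⟨s, hs ▸ e.2⟩ : ↥M) = e from Subtype.ext hs.symm]; exact he⟩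
    · exact Or.inl (hs ▸ k.2)
  · rintro (hs | ⟨h, hA⟩)
    · exact ⟨Sum.inr (⟨s, hs⟩, true), rfl, rfl⟩
    · exact ⟨Sum.inl ⟨s, h⟩, hA, rfl⟩

/-- The closed edge set of the pair system: `u ∪ {e ∈ M : ¬ A e} = η ∆ M`. [this work] -/
theorem colSet_false_eq (hd : Disjoint u M) (A : ↥M → Bool) :
    {s : Sym2 V | ∃ e, Sum.elim A Prod.snd e = false ∧
        Sum.elim (fun e : ↥M => (e : Sym2 V)) (fun p : ↥u × Bool => (p.1 : Sym2 V)) e = s} =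
      {s : Sym2 V | s ∈ u ∨ ∃ h : s ∈ M, A ⟨s, h⟩ = true} ∆ M := by
  ext s
  rw [Set.mem_symmDiff]
  constructor
  · rintro ⟨e, he, hs⟩
    rcases e with e | ⟨k, β⟩
    · refine Or.inr ⟨hs ▸ e.2, ?_⟩
      rintro (hsu | ⟨h, hA⟩)
      · exact Set.disjoint_left.1 hd hsu (hs ▸ e.2)
      · rw [show (⟨s, h⟩ : ↥M) = e from Subtype.ext hs.symm] at hA
        have he' : A e = false := he
        rw [hA] at he'; exact Bool.noConfusion he'
    · exact Or.inl ⟨Or.inl (hs ▸ k.2), fun hM => Set.disjoint_left.1 hd (hs ▸ k.2) hM⟩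
  · rintro (⟨hs | ⟨h, hA⟩, hM⟩ | ⟨hM, hn⟩)
    · exact ⟨Sum.inr (⟨s, hs⟩, false), rfl, rfl⟩
    · exact (hM h).elim
    · refine ⟨Sum.inl ⟨s, hM⟩, ?_, rfl⟩
      cases hA : A ⟨s, hM⟩
      · exact hA
      · exact (hn (Or.inr ⟨hM, hA⟩)).elim

/-- Reading a configuration of the fibre as a colouring and back. [this work] -/
theorem colSet_of_config {η : Set (Sym2 V)} (hη : η \ M = u) :
    {s : Sym2 V | s ∈ u ∨ ∃ h : s ∈ M, decide (((⟨s, h⟩ : ↥M) : Sym2 V) ∈ η) = true} = η := by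
  ext s
  simp only [Set.mem_setOf_eq, decide_eq_true_eq]
  constructor
  · rintro (hs | ⟨_, hs⟩)
    · rw [← hη] at hs; exact hs.1
    · exact hs
  · intro hs
    by_cases hM : s ∈ M
    · exact Or.inr ⟨hM, hs⟩
    · exact Or.inl (by rw [← hη]; exact ⟨hs, hM⟩)

/-- The colouring read off the configuration `u ∪ {e ∈ M : A e}` is `A`. [this work] -/
theorem config_of_colSet (hd : Disjoint u M) (A : ↥M → Bool) :
    (fun e : ↥M => decide ((e : Sym2 V) ∈ {s : Sym2 V | s ∈ u ∨ ∃ h : s ∈ M, A ⟨s, h⟩ = true})) = A := by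
  funext e
  rcases e with ⟨s, hs⟩
  by_cases hA : A ⟨s, hs⟩ = true
  · rw [hA, decide_eq_true_eq]; exact Or.inr ⟨hs, hA⟩
  · rw [Bool.not_eq_true] at hA
    rw [hA, decide_eq_false_iff_not]
    rintro (hsu | ⟨h, h'⟩)
    · exact Set.disjoint_left.1 hd hsu hs
    · rw [hA] at h'; exact Bool.noConfusion h'

/-- `u ∪ {e ∈ M : A e}` has value `u` off `M`. [this work] -/
theorem colSet_sdiff (hd : Disjoint u M) (A : ↥M → Bool) :
    {s : Sym2 V | s ∈ u ∨ ∃ h : s ∈ M, A ⟨s, h⟩ = true} \ M = u := by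
  ext s
  constructor
  · rintro ⟨hs | ⟨h, _⟩, hM⟩
    · exact hs
    · exact (hM h).elim
  · intro hs
    exact ⟨Or.inl hs, fun hM => Set.disjoint_left.1 hd hs hM⟩

/-- **Grades.**  `k(η) + k(η ∆ M)` is the grade of the corresponding colouring of the pair system.
[this work] -/
theorem clusterCount_add_eq_grade (hd : Disjoint u M) (A : ↥M → Bool) :
    clusterCount {s : Sym2 V | s ∈ u ∨ ∃ h : s ∈ M, A ⟨s, h⟩ = true} ∅ +
      clusterCount ({s : Sym2 V | s ∈ u ∨ ∃ h : s ∈ M, A ⟨s, h⟩ = true} ∆ M) ∅ =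
    Nat.card (fromEdgeSet {s : Sym2 V | ∃ e, Sum.elim A Prod.snd e = true ∧
        Sum.elim (fun e : ↥M => (e : Sym2 V)) (fun p : ↥u × Bool => (p.1 : Sym2 V)) e = s}).ConnectedComponent +
      Nat.card (fromEdgeSet {s : Sym2 V | ∃ e, Sum.elim A Prod.snd e = false ∧
        Sum.elim (fun e : ↥M => (e : Sym2 V)) (fun p : ↥u × Bool => (p.1 : Sym2 V)) e = s}).ConnectedComponent := by
  unfold clusterCount openGraph
  rw [wired_empty, sup_bot_eq, sup_bot_eq, colSet_true_eq A, colSet_false_eq hd A]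

/-- **Clusters, open.**  Reachability in the configuration `u ∪ {e ∈ M : A e}` is membership in the open
`AntipodalR1` cluster of the corresponding colouring of the pair system. [this work] -/
theorem reachable_iff_mem_clus_true (A : ↥M → Bool) (x v : V) :
    (openGraph ({s : Sym2 V | s ∈ u ∨ ∃ h : s ∈ M, A ⟨s, h⟩ = true} : Set (Sym2 V))).Reachable x v ↔
      v ∈ clus (Sum.elim (fun e : ↥M => (e : Sym2 V)) (fun p : ↥u × Bool => (p.1 : Sym2 V))) (Sum.elim A Prod.snd) true x := by
  rw [← reachable_iff_mem_clus, ← colSet_true_eq A]; rfl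

/-- **Clusters, closed.**  Reachability in the flipped configuration `(u ∪ {e ∈ M : A e}) ∆ M` is
membership in the closed `AntipodalR1` cluster of the corresponding colouring. [this work] -/
theorem reachable_iff_mem_clus_false (hd : Disjoint u M) (A : ↥M → Bool) (x v : V) :
    (openGraph ({s : Sym2 V | s ∈ u ∨ ∃ h : s ∈ M, A ⟨s, h⟩ = true} ∆ M)).Reachable x v ↔
      v ∈ clus (Sum.elim (fun e : ↥M => (e : Sym2 V)) (fun p : ↥u × Bool => (p.1 : Sym2 V))) (Sum.elim A Prod.snd) false x := by
  rw [← reachable_iff_mem_clus, ← colSet_false_eq hd A]; rfl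

/-- `Gladkov.cl` of `S.toFinset` (any `Fintype` instance) is reachability in `openGraph S`. [this work] -/
theorem mem_cl_toFinset_iff [Fintype V] {S : Set (Sym2 V)} {i : Fintype ↥S} {x v : V} :
    v ∈ cl (@Set.toFinset (Sym2 V) S i) x ↔ (openGraph S).Reachable x v := by
  rw [mem_cl, Set.coe_toFinset]

variable [Fintype V] [DecidableEq V]

/-- **Separation.**  Support separation of `b` from `c` (in `D₀ ⊇ M ∪ u`) by a vertex set `K` that is
the closed cluster of `a` implies that `c` lies outside the region of `b` in the pair system.
[this work] -/
theorem not_region_of_sep {D₀ : Finset (Sym2 V)} (hMD : M ∪ u ⊆ ↑D₀)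
    (A : ↥M → Bool) (a b c : V) {K : Finset V}
    (hK : ∀ v, v ∈ K ↔ v ∈ clus (Sum.elim (fun e : ↥M => (e : Sym2 V)) (fun p : ↥u × Bool => (p.1 : Sym2 V))) (Sum.elim A Prod.snd) false a)
    (hsep : Sep D₀ K b c) :
    c ∉ region (Sum.elim (fun e : ↥M => (e : Sym2 V)) (fun p : ↥u × Bool => (p.1 : Sym2 V)))
      (Sum.elim A Prod.snd) a b := by
  intro hc
  have key : ∀ v, ReflTransGen (fun p q => q ∈ freeNbr
      (Sum.elim (fun e : ↥M => (e : Sym2 V)) (fun p : ↥u × Bool => (p.1 : Sym2 V)))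
      (Sum.elim A Prod.snd) a p) b v →
      (openGraph (↑(D₀ \ touch K) : Set (Sym2 V))).Reachable b v := by
    intro v hv
    induction hv with
    | refl => exact Reachable.refl _
    | @tail p q _ hpq ih =>
      obtain ⟨⟨e, he⟩, hpK, hqK⟩ := hpq
      have hpK' : p ∉ K := fun h => hpK ((hK p).1 h)
      have hqK' : q ∉ K := fun h => hqK ((hK q).1 h)
      by_cases hpq' : p = q
      · rw [← hpq']; exact ih
      · refine ih.trans (Adj.reachable ?_)
        rw [Literature.Probability.Percolation.openGraph_adj]
        refine ⟨?_, hpq'⟩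
        rw [Finset.mem_coe, Finset.mem_sdiff]
        refine ⟨hMD ?_, fun h => ?_⟩
        · rcases e with e' | ⟨k, β⟩
          · exact Or.inl (by rw [← show (e' : Sym2 V) = s(p, q) from he]; exact e'.2)
          · exact Or.inr (by rw [← show (k : Sym2 V) = s(p, q) from he]; exact k.2)
        · rcases mk_mem_touch.1 h with h | h
          · exact hpK' h
          · exact hqK' h
  exact hsep (mem_cl.2 (key c (mem_region.1 hc)))

end Fibre

section Counts

variable [Fintype V] [DecidableEq V] {M u : Set (Sym2 V)}

/-- **The `L`-side fibre count is at most the fibre-form `L`-count.** [this work] -/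
theorem fibreCount_L_le (hd : Disjoint u M) {D₀ : Finset (Sym2 V)} (hMD : M ∪ u ⊆ ↑D₀) (a b c : V)
    (t : ℕ) :
    ((Finset.univ.filter fun η : Set (Sym2 V) => η \ M = u ∧
        η ∈ {η : BondConfig V | b ∈ cl η.toFinset a ∧ c ∈ cl η.toFinset a} ∧
        η ∆ M ∈ {η : BondConfig V | b ∉ cl η.toFinset a ∧ c ∉ cl η.toFinset a ∧ Sep D₀ (cl η.toFinset a) b c}).filter
        fun η => clusterCount η ∅ + clusterCount (η ∆ M) ∅ = t).card ≤
    (Finset.univ.filter fun A : ↥M → Bool =>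
        Sum.elim A Prod.snd ∈ lSet (Sum.elim (fun e : ↥M => (e : Sym2 V)) (fun p : ↥u × Bool => (p.1 : Sym2 V))) a b c ∧
      (Nat.card (fromEdgeSet {s : Sym2 V | ∃ e, Sum.elim A Prod.snd e = true ∧
        (Sum.elim (fun e : ↥M => (e : Sym2 V)) (fun p : ↥u × Bool => (p.1 : Sym2 V))) e = s}).ConnectedComponent +
      Nat.card (fromEdgeSet {s : Sym2 V | ∃ e, Sum.elim A Prod.snd e = false ∧
        (Sum.elim (fun e : ↥M => (e : Sym2 V)) (fun p : ↥u × Bool => (p.1 : Sym2 V))) e = s}).ConnectedComponent) = t).card := by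
  refine Finset.card_le_card_of_injOn (fun η => fun e : ↥M => decide ((e : Sym2 V) ∈ η)) ?_ ?_
  · intro η hη
    rw [Finset.mem_coe, Finset.mem_filter] at hη
    obtain ⟨hη1, hgr⟩ := hη
    obtain ⟨hηu, hT, hS⟩ := (Finset.mem_filter.1 hη1).2
    have hΦ : {s : Sym2 V | s ∈ u ∨ ∃ h : s ∈ M, decide (((⟨s, h⟩ : ↥M) : Sym2 V) ∈ η) = true} = η :=
      colSet_of_config hηu
    have hT1 := mem_cl_toFinset_iff.1 hT.1
    have hT2 := mem_cl_toFinset_iff.1 hT.2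
    rw [← hΦ] at hT1 hT2
    rw [Finset.mem_coe, Finset.mem_filter]
    refine ⟨Finset.mem_univ _, ?_, ?_⟩
    · have hOb := (reachable_iff_mem_clus_true (u := u)
        (fun e : ↥M => decide ((e : Sym2 V) ∈ η)) a b).1 hT1
      have hOc := (reachable_iff_mem_clus_true (u := u)
        (fun e : ↥M => decide ((e : Sym2 V) ∈ η)) a c).1 hT2
      have hKb : b ∉ clus (Sum.elim (fun e : ↥M => (e : Sym2 V)) (fun p : ↥u × Bool => (p.1 : Sym2 V)))
          (Sum.elim (fun e : ↥M => decide ((e : Sym2 V) ∈ η)) Prod.snd) false a := by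
        intro h
        have h' := (reachable_iff_mem_clus_false hd (fun e : ↥M => decide ((e : Sym2 V) ∈ η)) a b).2 h
        rw [hΦ] at h'
        exact hS.1 (mem_cl_toFinset_iff.2 h')
      have hKc : c ∉ clus (Sum.elim (fun e : ↥M => (e : Sym2 V)) (fun p : ↥u × Bool => (p.1 : Sym2 V)))
          (Sum.elim (fun e : ↥M => decide ((e : Sym2 V) ∈ η)) Prod.snd) false a := by
        intro h
        have h' := (reachable_iff_mem_clus_false hd (fun e : ↥M => decide ((e : Sym2 V) ∈ η)) a c).2 h
        rw [hΦ] at h'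
        exact hS.2.1 (mem_cl_toFinset_iff.2 h')
      have hK : ∀ v, v ∈ cl (η ∆ M).toFinset a ↔ v ∈ clus (Sum.elim (fun e : ↥M => (e : Sym2 V)) (fun p : ↥u × Bool => (p.1 : Sym2 V)))
          (Sum.elim (fun e : ↥M => decide ((e : Sym2 V) ∈ η)) Prod.snd) false a := by
        intro v
        rw [mem_cl_toFinset_iff, ← reachable_iff_mem_clus_false hd, hΦ]
      have hreg := not_region_of_sep hMD (fun e : ↥M => decide ((e : Sym2 V) ∈ η)) a b c hK hS.2.2
      exact Finset.mem_filter.2 ⟨Finset.mem_univ _, hOb, hKb, hOc, hKc, hreg⟩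
    · rw [← clusterCount_add_eq_grade hd, hΦ]; exact hgr
  · intro η hη η' hη' hAA
    rw [Finset.mem_coe, Finset.mem_filter] at hη hη'
    have hηu : η \ M = u := (Finset.mem_filter.1 hη.1).2.1
    have hη'u : η' \ M = u := (Finset.mem_filter.1 hη'.1).2.1
    have h1 := colSet_of_config (M := M) hηu
    have h2 := colSet_of_config (M := M) hη'u
    rw [← h1, ← h2]
    ext s
    simp only [Set.mem_setOf_eq]
    have key : ∀ h : s ∈ M, decide (((⟨s, h⟩ : ↥M) : Sym2 V) ∈ η) =
        decide (((⟨s, h⟩ : ↥M) : Sym2 V) ∈ η') := fun h => congrFun hAA ⟨s, h⟩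
    constructor
    · rintro (hs | ⟨h, hA⟩)
      · exact Or.inl hs
      · exact Or.inr ⟨h, by rw [← key h]; exact hA⟩
    · rintro (hs | ⟨h, hA⟩)
      · exact Or.inl hs
      · exact Or.inr ⟨h, by rw [key h]; exact hA⟩

/-- **The `R`-side fibre count is at least the fibre-form `R`-count.** [this work] -/
theorem fibreCount_R_ge (hd : Disjoint u M) (a b c : V) (t : ℕ) :
    (Finset.univ.filter fun A : ↥M → Bool =>
        Sum.elim A Prod.snd ∈ rSet (Sum.elim (fun e : ↥M => (e : Sym2 V)) (fun p : ↥u × Bool => (p.1 : Sym2 V))) a b c ∧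
      (Nat.card (fromEdgeSet {s : Sym2 V | ∃ e, Sum.elim A Prod.snd e = true ∧
        (Sum.elim (fun e : ↥M => (e : Sym2 V)) (fun p : ↥u × Bool => (p.1 : Sym2 V))) e = s}).ConnectedComponent +
      Nat.card (fromEdgeSet {s : Sym2 V | ∃ e, Sum.elim A Prod.snd e = false ∧
        (Sum.elim (fun e : ↥M => (e : Sym2 V)) (fun p : ↥u × Bool => (p.1 : Sym2 V))) e = s}).ConnectedComponent) = t).card ≤
    ((Finset.univ.filter fun η : Set (Sym2 V) => η \ M = u ∧
        η ∈ {η : BondConfig V | b ∈ cl η.toFinset a ∧ c ∉ cl η.toFinset a} ∧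
        η ∆ M ∈ {η : BondConfig V | b ∉ cl η.toFinset a ∧ c ∈ cl η.toFinset a}).filter
        fun η => clusterCount η ∅ + clusterCount (η ∆ M) ∅ = t).card := by
  refine Finset.card_le_card_of_injOn
    (fun A : ↥M → Bool => {s : Sym2 V | s ∈ u ∨ ∃ h : s ∈ M, A ⟨s, h⟩ = true}) ?_ ?_
  · intro A hA
    rw [Finset.mem_coe, Finset.mem_filter] at hA
    obtain ⟨-, hR, hgr⟩ := hA
    obtain ⟨hOb, hKb, hKc, hOc⟩ := (Finset.mem_filter.1 hR).2
    rw [Finset.mem_coe, Finset.mem_filter]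
    refine ⟨Finset.mem_filter.2 ⟨Finset.mem_univ _, colSet_sdiff hd A, ⟨?_, ?_⟩, ?_, ?_⟩, ?_⟩
    · exact mem_cl_toFinset_iff.2 ((reachable_iff_mem_clus_true A a b).2 hOb)
    · exact fun h => hOc ((reachable_iff_mem_clus_true A a c).1 (mem_cl_toFinset_iff.1 h))
    · exact fun h => hKb ((reachable_iff_mem_clus_false hd A a b).1 (mem_cl_toFinset_iff.1 h))
    · exact mem_cl_toFinset_iff.2 ((reachable_iff_mem_clus_false hd A a c).2 hKc)
    · rw [clusterCount_add_eq_grade hd]; exact hgr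
  · intro A _ A' _ hAA
    funext e
    have key : ∀ B : ↥M → Bool,
        ((e : Sym2 V) ∈ {s : Sym2 V | s ∈ u ∨ ∃ h : s ∈ M, B ⟨s, h⟩ = true}) ↔ B e = true := by
      intro B
      constructor
      · rintro (hu | ⟨h, hB⟩)
        · exact (Set.disjoint_left.1 hd hu e.2).elim
        · rw [Subtype.coe_eta] at hB; exact hB
      · intro hB
        exact Or.inr ⟨e.2, by rw [Subtype.coe_eta]; exact hB⟩
    have hA := key A
    have hA' := key A'
    rw [show ({s : Sym2 V | s ∈ u ∨ ∃ h : s ∈ M, A ⟨s, h⟩ = true} : Set (Sym2 V)) =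
      {s : Sym2 V | s ∈ u ∨ ∃ h : s ∈ M, A' ⟨s, h⟩ = true} from hAA] at hA
    exact Bool.eq_iff_iff.2 (hA.symm.trans hA')

end Counts

/-- **LEMMA F** (memo `KCLUSTER-gen52` §1): **graded ANTI₁ on every finite multigraph with vertex type
`V` implies the refined row R1 for the free random-cluster measures on `V`, for EVERY `q > 0` and every
edge-parameter vector.**  Hypothesis: for every edge set `M ⊆ Sym2 V` used as edge index type, every
system `ends' : ↥M → Sym2 V`, all `a, b, c` and all levels `t`,
`#{x ∈ L(ends'; a, b, c) : g(x) = t} ≤ #{x ∈ R(ends'; a; b, c) : g(x) = t}`.  Conclusion (the form of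
`ThreeSum.kThreeN_r1`): for `w` vanishing off `D₀`, `φ = rcMeasureW w q ∅`,
`φ{b, c ∈ C_a} · φ{b, c ∉ C_a, C_a separates b | c in D₀} ≤ φ{b ∈ C_a, c ∉ C_a} · φ{b ∉ C_a, c ∈ C_a}`.
[this work] -/
theorem r1_rc_of_graded_anti1 [Fintype V] [DecidableEq V]
    (H : ∀ (M : Set (Sym2 V)) (ends' : ↥M → Sym2 V) (a b c : V) (t : ℕ),
      (Finset.univ.filter fun x : ↥M → Bool => x ∈ lSet ends' a b c ∧
        (Nat.card (fromEdgeSet {s : Sym2 V | ∃ e, x e = true ∧ ends' e = s}).ConnectedComponent +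
        Nat.card (fromEdgeSet {s : Sym2 V | ∃ e, x e = false ∧ ends' e = s}).ConnectedComponent) = t).card ≤
      (Finset.univ.filter fun x : ↥M → Bool => x ∈ rSet ends' a b c ∧
        (Nat.card (fromEdgeSet {s : Sym2 V | ∃ e, x e = true ∧ ends' e = s}).ConnectedComponent +
        Nat.card (fromEdgeSet {s : Sym2 V | ∃ e, x e = false ∧ ends' e = s}).ConnectedComponent) = t).card)
    (w : Sym2 V → unitInterval) {q : ℝ} (hq : 0 < q) (D₀ : Finset (Sym2 V))
    (hw : ∀ e, e ∉ D₀ → (w e : ℝ) = 0) (a b c : V) :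
    (rcMeasureW w q ∅).real {η : BondConfig V | b ∈ cl η.toFinset a ∧ c ∈ cl η.toFinset a} *
        (rcMeasureW w q ∅).real {η : BondConfig V | b ∉ cl η.toFinset a ∧ c ∉ cl η.toFinset a ∧ Sep D₀ (cl η.toFinset a) b c} ≤
      (rcMeasureW w q ∅).real {η : BondConfig V | b ∈ cl η.toFinset a ∧ c ∉ cl η.toFinset a} *
        (rcMeasureW w q ∅).real {η : BondConfig V | b ∉ cl η.toFinset a ∧ c ∈ cl η.toFinset a} := by
  refine rcMeasureW_real_mul_le_of_graded_fibrewise w hq ∅ (↑D₀ : Set (Sym2 V))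
    (fun e he => hw e (fun h => he (Finset.mem_coe.2 h))) _ _ _ _ ?_
  intro M u hd hMD t
  have key := (fibreCount_L_le hd hMD a b c t).trans
    ((card_fibreForm_grade_le_of_graded (H M) (↥u) (fun k : ↥u => (k : Sym2 V))
      (fun e : ↥M => (e : Sym2 V)) a b c t).trans (fibreCount_R_ge hd a b c t))
  refine le_of_eq_of_le (congrArg Finset.card ?_) (key.trans (le_of_eq (congrArg Finset.card ?_)))
  · ext η
    simp only [Finset.mem_filter, Finset.mem_univ, true_and, Set.mem_setOf_eq]
  · ext η
    simp only [Finset.mem_filter, Finset.mem_univ, true_and, Set.mem_setOf_eq]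


end AntipodalR1

end Summit.CriticalPhenomena.PercolationContinuityZ3.Theorems
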